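import Mathlib
import HarnessLib
import Summits.AtomisticToContinuum.FouriersLaw.Theses.JunctionLocality
import Summits.AtomisticToContinuum.FouriersLaw.Theorems.JunctionLocalitySuperadditiveResistanceKuboFrame
import Summits.AtomisticToContinuum.FouriersLaw.Theorems.JunctionLocalitySuperadditiveResistanceStubKuboFrameAux1
import Summits.AtomisticToContinuum.FouriersLaw.Theorems.JunctionLocalitySuperadditiveResistanceTerminationIdentity

/-!
# Junction curvature of the probed END fields, I: `S_K`-pairings of a non-compactly-supported field with the pair's polynomials
(stub `stub_junctionCurvature` of line `thermalise-then-cut-probe-insertion`, crux `JunctionLocality.SuperadditiveResistance`,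
stmt-AtomisticToContinuum-11748; helper file, `--supports`)

The stub asks, `N`-UNIFORMLY over all Kubo frames `KuboFrame P T N M g gb₁ gb₄` of the γ-probed device
(`P = pinnedChain ω₂ lam β γ`), for `‖S_K gb₁‖²_{L²(μ_T)} ≤ C₃ (selfLeft g)²` and `‖S_K gb₄‖² ≤ C₃ (selfRight g)²`
(`S_K = junctionOU`: two momentum derivatives of the END-bath forward fields at the probed pair `p_{N−1}, p_N`). This
part lands the analytic inputs of the exact energy-channel split of `‖S_K f‖²` (part III, `…StubJunctionCurvature`), for
the pinned chain (`ω₂, T > 0`, `lam, β ≥ 0`, `N, M ≥ 1`) and ANY `f ∈ C²` with `f, S_K f ∈ L²(μ_T)` — no equation, no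
support or growth condition (the class of the line's forward fields `IsForwardField`):

* `junctionOU_sub_const_mul`, `junctionOU_eK` — `S_K(f − c e) = S_K f − c S_K e` on `C²`, `S_K e_K = (2T − p²_{N−1} − p²_N)/T²`;
* `integral_junctionOU_mul_eK` — `⟨S_K f, e_K⟩_{μ_T} = ⟨f, S_K e_K⟩_{μ_T}` (the landed symmetric pairing
  `InsertionToolbox.pinnedChain_integral_ouSum_mul_comm`, whose cut-offs are already removed);
* `integral_junctionOU_eq_zero` — `∫ S_K f dμ_T = 0` (pair `S_K f` with `1`);
* `integral_kinPair_sq` — Gaussian fourth moments at the pair: `‖(p²_{N−1} − T) + (p²_N − T)‖²_{L²(μ_T)} = 4T²` (`Kubo.gauss_ibp`);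
* `helper_curvaturePairings` (registered) — the three pairings bundled; `memLp_kin_sub_line` — `p_s² − T ∈ L²(μ_T)`.

Part II (`…StubJunctionCurvatureDirichlet`): the free `N`-uniform first-derivative budget of the Kubo frame. No
definitions; standard axioms; folklore (Gaussian integration by parts, Ornstein–Uhlenbeck symmetry).
-/

noncomputable section

open MeasureTheory Filter Topology ProbabilityTheory
open scoped ContDiff NNReal ENNReal
open Literature.MathematicalPhysics.KineticTheory.HeatConduction

namespace Summit.AtomisticToContinuum.FouriersLaw.Cruxes.SuperadditiveResistance.ThermaliseThenCutProbeInsertion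

open Summit.AtomisticToContinuum.FouriersLaw.Theorems.SuperadditiveResistance
open Summit.AtomisticToContinuum.FouriersLaw.Theorems.SuperadditiveResistance.Kubo
  (fluctuation_dissipation memLp_partialP memLp_kinetic memLp_momentum gauss_ibp integrable_mul_mul_gibbsDensity
    integrable_sq_mul_gibbsDensity integrable_mul_gibbsDensity_iff integral_sq_mul_gibbsDensity_eq)
open Summit.AtomisticToContinuum.FouriersLaw.Theorems.SuperadditiveResistance.DeviceLiouville
  (liouvilleOp bathOp deviceWeight deviceGenerator_eq kin_eq_sq partialP_sub differentiable_partialP_of_contDiff_two)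

section EnergyChannel

variable {ω₂ lam β γ : ℝ} {N M : ℕ}

open Summit.AtomisticToContinuum.FouriersLaw.Cruxes.SuperadditiveResistance.InsertionToolbox
  (pinnedChain_integral_ouSum_mul_comm)
open Summit.AtomisticToContinuum.FouriersLaw.Cruxes.SuperadditiveResistance.InsertionToolbox.Assembly
  (junctionOU_eq junctionSC_eK partialP_eK contDiff_eK memLp_eK partialP_sq_coord)

/-- `kin L s − T ∈ L²(μ_T)` for the pinned chain (`s < L`). -/
theorem memLp_kin_sub_line (hω : 0 < ω₂) (hl : 0 ≤ lam) (hβ : 0 ≤ β) (γ : ℝ) {L s : ℕ} (hs : s < L)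
    {T : ℝ} (hT : 0 < T) :
    MemLp (fun x : PhaseSpace L => kin L s x - T) 2 ((pinnedChain ω₂ lam β γ).gibbsMeasure L T) := by
  have e : (fun x : PhaseSpace L => kin L s x - T) = fun x => x.2 ⟨s, hs⟩ ^ 2 - T := by
    funext x; rw [kin_eq_sq_line hs]
  rw [e]; exact memLp_kinetic (γ := γ) hω hl hβ L hT ⟨s, hs⟩


/-- `thermo` is linear on `C²` (subtraction). -/
theorem thermo_sub_line {L : ℕ} (s : ℕ) (θ : ℝ) {f e : PhaseSpace L → ℝ} (hf : ContDiff ℝ 2 f)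
    (he : ContDiff ℝ 2 e) (x : PhaseSpace L) :
    thermo L s θ (fun y => f y - e y) x = thermo L s θ f x - thermo L s θ e x := by
  have hfd := hf.differentiable two_ne_zero
  have hed := he.differentiable two_ne_zero
  unfold thermo
  rw [← Finset.sum_sub_distrib]
  refine Finset.sum_congr rfl fun i _ => ?_
  split_ifs with h
  · have h1 : partialP i (fun y => f y - e y) = fun y => partialP i f y - partialP i e y :=
      funext fun y => partialP_sub hfd hed i y
    rw [h1, partialP_sub (differentiable_partialP_of_contDiff_two hf i)
      (differentiable_partialP_of_contDiff_two he i)]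
    ring
  · simp

/-- `thermo` is linear on `C²` (scalars). -/
theorem thermo_const_mul_line {L : ℕ} (s : ℕ) (θ : ℝ) {e : PhaseSpace L → ℝ} (he : ContDiff ℝ 2 e) (c : ℝ)
    (x : PhaseSpace L) :
    thermo L s θ (fun y => c * e y) x = c * thermo L s θ e x := by
  have hed := he.differentiable two_ne_zero
  unfold thermo
  rw [Finset.mul_sum]
  refine Finset.sum_congr rfl fun i _ => ?_
  split_ifs with h
  · have h1 : partialP i (fun y => c * e y) = fun y => c * partialP i e y :=
      funext fun y => InsertionToolbox.partialP_const_mul hed c i y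
    rw [h1, InsertionToolbox.partialP_const_mul (differentiable_partialP_of_contDiff_two he i)]
    ring
  · simp

/-- `S_K (f − c·e) = S_K f − c·S_K e` pointwise (`f, e ∈ C²`). -/
theorem junctionOU_sub_const_mul {T : ℝ} {f e : PhaseSpace (N + M) → ℝ} (hf : ContDiff ℝ 2 f)
    (he : ContDiff ℝ 2 e) (c : ℝ) (x : PhaseSpace (N + M)) :
    junctionOU T N M (fun y => f y - c * e y) x = junctionOU T N M f x - c * junctionOU T N M e x := by
  have hce : ContDiff ℝ 2 (fun y => c * e y) := contDiff_const.mul he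
  unfold junctionOU
  rw [thermo_sub_line _ _ hf hce, thermo_sub_line _ _ hf hce, thermo_const_mul_line _ _ he,
    thermo_const_mul_line _ _ he]
  ring

/-- `S_K e_K = (2T − p²_{N−1} − p²_N)/T²` (the landed `junctionSC_eK`, in the line's vocabulary). -/
theorem junctionOU_eK (hN : 1 ≤ N) (hM : 1 ≤ M) {T : ℝ} (hT : T ≠ 0) (x : PhaseSpace (N + M)) :
    junctionOU T N M (eK T N M) x = (2 * T - kin (N + M) (N - 1) x - kin (N + M) N x) / T ^ 2 :=
  (junctionOU_eq T N M (eK T N M) x).trans (junctionSC_eK hN hM hT x)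

/-- `S_K f` as the weighted thermostat sum of the insertion toolbox. -/
theorem junctionOU_eq_weighted (T : ℝ) (u : PhaseSpace (N + M) → ℝ) (x : PhaseSpace (N + M)) :
    junctionOU T N M u x = ∑ i : Fin (N + M),
      ((if i.val = N - 1 then (1 : ℝ) else 0) + (if i.val = N then (1 : ℝ) else 0)) *
        (T * partialP i (partialP i u) x - x.2 i * partialP i u x) :=
  junctionOU_eq T N M u x

/-- **`S_K` moves onto `e_K`**: `⟨S_K f, e_K⟩_{μ_T} = ⟨f, S_K e_K⟩_{μ_T}` for `f ∈ C²` with `f, S_K f ∈ L²(μ_T)`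
(no equation and no support condition on `f`; the landed symmetric pairing `pinnedChain_integral_ouSum_mul_comm`). -/
theorem integral_junctionOU_mul_eK (hω : 0 < ω₂) (hl : 0 ≤ lam) (hβ : 0 ≤ β) (γ : ℝ) {T : ℝ} (hT : 0 < T)
    (hN : 1 ≤ N) (hM : 1 ≤ M) {f : PhaseSpace (N + M) → ℝ} (hfC : ContDiff ℝ 2 f)
    (hfL2 : MemLp f 2 ((pinnedChain ω₂ lam β γ).gibbsMeasure (N + M) T))
    (hSf : MemLp (junctionOU T N M f) 2 ((pinnedChain ω₂ lam β γ).gibbsMeasure (N + M) T)) :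
    ∫ x, junctionOU T N M f x * eK T N M x ∂((pinnedChain ω₂ lam β γ).gibbsMeasure (N + M) T) =
      ∫ x, f x * ((2 * T - kin (N + M) (N - 1) x - kin (N + M) N x) / T ^ 2)
        ∂((pinnedChain ω₂ lam β γ).gibbsMeasure (N + M) T) := by
  haveI := pinnedChain_isProbabilityMeasure_gibbsMeasure hω hl hβ γ (N + M) hT
  set μ := (pinnedChain ω₂ lam β γ).gibbsMeasure (N + M) T with hμ
  have hSL2' : MemLp (fun x => ∑ i : Fin (N + M),
      ((if i.val = N - 1 then (1 : ℝ) else 0) + (if i.val = N then (1 : ℝ) else 0)) *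
        (T * partialP i (partialP i f) x - x.2 i * partialP i f x)) 2 μ :=
    (memLp_congr_ae (ae_of_all _ fun x => junctionOU_eq_weighted T f x)).mp hSf
  have hv : ContDiff ℝ 2 (eK T N M) := contDiff_eK T
  have hvL2 : MemLp (eK T N M) 2 μ := memLp_eK hω hl hβ γ N M hT
  have hSv_eq : ∀ x, (∑ i : Fin (N + M),
      ((if i.val = N - 1 then (1 : ℝ) else 0) + (if i.val = N then (1 : ℝ) else 0)) *
        (T * partialP i (partialP i (eK T N M)) x - x.2 i * partialP i (eK T N M) x)) =
      (2 * T - kin (N + M) (N - 1) x - kin (N + M) N x) / T ^ 2 := fun x => junctionSC_eK hN hM hT.ne' x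
  have hSvL2 : MemLp (fun x => ∑ i : Fin (N + M),
      ((if i.val = N - 1 then (1 : ℝ) else 0) + (if i.val = N then (1 : ℝ) else 0)) *
        (T * partialP i (partialP i (eK T N M)) x - x.2 i * partialP i (eK T N M) x)) 2 μ := by
    have e : (fun x => ∑ i : Fin (N + M),
        ((if i.val = N - 1 then (1 : ℝ) else 0) + (if i.val = N then (1 : ℝ) else 0)) *
          (T * partialP i (partialP i (eK T N M)) x - x.2 i * partialP i (eK T N M) x)) = fun x =>
        (-(1 / T ^ 2)) * ((kin (N + M) (N - 1) x - T) + (kin (N + M) N x - T)) := by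
      funext x; rw [hSv_eq]; field_simp; ring
    rw [e]
    exact ((memLp_kin_sub_line hω hl hβ γ (s := N - 1) (by omega) hT).add
      (memLp_kin_sub_line hω hl hβ γ (s := N) (by omega) hT)).const_mul _
  have hdv : ∀ i : Fin (N + M), ((if i.val = N - 1 then (1 : ℝ) else 0) + (if i.val = N then (1 : ℝ) else 0)) ≠ 0 →
      MemLp (partialP i (eK T N M)) 2 μ := by
    intro i _
    have e : partialP i (eK T N M) = fun x : PhaseSpace (N + M) => (1 / (2 * T ^ 2)) *
        ((if (⟨N - 1, by omega⟩ : Fin (N + M)) = i then 2 * x.2 ⟨N - 1, by omega⟩ else 0) +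
          (if (⟨N, by omega⟩ : Fin (N + M)) = i then 2 * x.2 ⟨N, by omega⟩ else 0)) :=
      funext fun x => partialP_eK hN hM T i x
    have h1 : MemLp (fun x : PhaseSpace (N + M) =>
        (if (⟨N - 1, by omega⟩ : Fin (N + M)) = i then 2 * x.2 ⟨N - 1, by omega⟩ else (0 : ℝ))) 2 μ := by
      by_cases h : (⟨N - 1, by omega⟩ : Fin (N + M)) = i
      · simp only [h, if_true]; exact (memLp_momentum hω hl hβ (N + M) hT _).const_mul 2
      · simp only [h, if_false]; exact memLp_const 0
    have h2 : MemLp (fun x : PhaseSpace (N + M) =>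
        (if (⟨N, by omega⟩ : Fin (N + M)) = i then 2 * x.2 ⟨N, by omega⟩ else (0 : ℝ))) 2 μ := by
      by_cases h : (⟨N, by omega⟩ : Fin (N + M)) = i
      · simp only [h, if_true]; exact (memLp_momentum hω hl hβ (N + M) hT _).const_mul 2
      · simp only [h, if_false]; exact memLp_const 0
    have h12 : MemLp (fun x : PhaseSpace (N + M) =>
        (1 / (2 * T ^ 2)) * ((if (⟨N - 1, by omega⟩ : Fin (N + M)) = i then 2 * x.2 ⟨N - 1, by omega⟩ else (0 : ℝ)) +
          (if (⟨N, by omega⟩ : Fin (N + M)) = i then 2 * x.2 ⟨N, by omega⟩ else (0 : ℝ)))) 2 μ :=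
      (h1.add h2).const_mul _
    rw [e]
    exact h12
  have key := pinnedChain_integral_ouSum_mul_comm hω hl hβ γ (N + M) hT _ hfC hfL2 hSL2' hv hvL2 hSvL2 hdv
  calc ∫ x, junctionOU T N M f x * eK T N M x ∂μ
        = ∫ x, (∑ i : Fin (N + M),
            ((if i.val = N - 1 then (1 : ℝ) else 0) + (if i.val = N then (1 : ℝ) else 0)) *
              (T * partialP i (partialP i f) x - x.2 i * partialP i f x)) * eK T N M x ∂μ :=
          integral_congr_ae (ae_of_all _ fun x => by simp only [junctionOU_eq_weighted T f x])
    _ = _ := key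
    _ = _ := integral_congr_ae (ae_of_all _ fun x => by simp only [hSv_eq x])

/-- **`S_K f` has mean zero**: `∫ S_K f dμ_T = 0` for `f ∈ C²` with `f, S_K f ∈ L²(μ_T)` (pair `S_K f` with `1`). -/
theorem integral_junctionOU_eq_zero (hω : 0 < ω₂) (hl : 0 ≤ lam) (hβ : 0 ≤ β) (γ : ℝ) {T : ℝ} (hT : 0 < T)
    {f : PhaseSpace (N + M) → ℝ} (hfC : ContDiff ℝ 2 f)
    (hfL2 : MemLp f 2 ((pinnedChain ω₂ lam β γ).gibbsMeasure (N + M) T))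
    (hSf : MemLp (junctionOU T N M f) 2 ((pinnedChain ω₂ lam β γ).gibbsMeasure (N + M) T)) :
    ∫ x, junctionOU T N M f x ∂((pinnedChain ω₂ lam β γ).gibbsMeasure (N + M) T) = 0 := by
  haveI := pinnedChain_isProbabilityMeasure_gibbsMeasure hω hl hβ γ (N + M) hT
  set μ := (pinnedChain ω₂ lam β γ).gibbsMeasure (N + M) T with hμ
  have hSL2' : MemLp (fun x => ∑ i : Fin (N + M),
      ((if i.val = N - 1 then (1 : ℝ) else 0) + (if i.val = N then (1 : ℝ) else 0)) *
        (T * partialP i (partialP i f) x - x.2 i * partialP i f x)) 2 μ :=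
    (memLp_congr_ae (ae_of_all _ fun x => junctionOU_eq_weighted T f x)).mp hSf
  have hv : ContDiff ℝ 2 (fun _ : PhaseSpace (N + M) => (1 : ℝ)) := contDiff_const
  have hvL2 : MemLp (fun _ : PhaseSpace (N + M) => (1 : ℝ)) 2 μ := memLp_const 1
  have hd1 : ∀ i : Fin (N + M), partialP i (fun _ : PhaseSpace (N + M) => (1 : ℝ)) = fun _ => 0 :=
    fun i => funext fun x => DeviceLiouville.partialP_const i 1 x
  have hd0 : ∀ i : Fin (N + M), partialP i (fun _ : PhaseSpace (N + M) => (0 : ℝ)) = fun _ => 0 :=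
    fun i => funext fun x => DeviceLiouville.partialP_const i 0 x
  have hSv0 : ∀ x : PhaseSpace (N + M), (∑ i : Fin (N + M),
      ((if i.val = N - 1 then (1 : ℝ) else 0) + (if i.val = N then (1 : ℝ) else 0)) *
        (T * partialP i (partialP i (fun _ : PhaseSpace (N + M) => (1 : ℝ))) x -
          x.2 i * partialP i (fun _ : PhaseSpace (N + M) => (1 : ℝ)) x)) = 0 := by
    intro x
    refine Finset.sum_eq_zero fun i _ => ?_
    rw [hd1 i, hd0 i]
    ring
  have hSvL2 : MemLp (fun x : PhaseSpace (N + M) => ∑ i : Fin (N + M),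
      ((if i.val = N - 1 then (1 : ℝ) else 0) + (if i.val = N then (1 : ℝ) else 0)) *
        (T * partialP i (partialP i (fun _ : PhaseSpace (N + M) => (1 : ℝ))) x -
          x.2 i * partialP i (fun _ : PhaseSpace (N + M) => (1 : ℝ)) x)) 2 μ := by
    rw [show (fun x : PhaseSpace (N + M) => ∑ i : Fin (N + M),
      ((if i.val = N - 1 then (1 : ℝ) else 0) + (if i.val = N then (1 : ℝ) else 0)) *
        (T * partialP i (partialP i (fun _ : PhaseSpace (N + M) => (1 : ℝ))) x -
          x.2 i * partialP i (fun _ : PhaseSpace (N + M) => (1 : ℝ)) x)) = fun _ => (0 : ℝ) from funext hSv0]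
    exact memLp_const 0
  have hdv : ∀ i : Fin (N + M), ((if i.val = N - 1 then (1 : ℝ) else 0) + (if i.val = N then (1 : ℝ) else 0)) ≠ 0 →
      MemLp (partialP i (fun _ : PhaseSpace (N + M) => (1 : ℝ))) 2 μ := fun i _ => by
    rw [hd1 i]; exact memLp_const 0
  have key := pinnedChain_integral_ouSum_mul_comm hω hl hβ γ (N + M) hT _ hfC hfL2 hSL2' hv hvL2 hSvL2 hdv
  have hR : ∫ x, f x * (∑ i : Fin (N + M),
      ((if i.val = N - 1 then (1 : ℝ) else 0) + (if i.val = N then (1 : ℝ) else 0)) *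
        (T * partialP i (partialP i (fun _ : PhaseSpace (N + M) => (1 : ℝ))) x -
          x.2 i * partialP i (fun _ : PhaseSpace (N + M) => (1 : ℝ)) x)) ∂μ = 0 := by
    simp only [hSv0, mul_zero, integral_zero]
  calc ∫ x, junctionOU T N M f x ∂μ
        = ∫ x, (∑ i : Fin (N + M),
            ((if i.val = N - 1 then (1 : ℝ) else 0) + (if i.val = N then (1 : ℝ) else 0)) *
              (T * partialP i (partialP i f) x - x.2 i * partialP i f x)) * (fun _ : PhaseSpace (N + M) => (1 : ℝ)) x ∂μ :=
          integral_congr_ae (ae_of_all _ fun x => by simp only [junctionOU_eq_weighted T f x, mul_one])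
    _ = _ := key
    _ = 0 := hR

/-- `∂_{p_i}(p_a² − T) = 2 p_a δ_{ia}`. -/
theorem partialP_kinetic_coord {L : ℕ} (T : ℝ) (i a : Fin L) (x : PhaseSpace L) :
    partialP i (fun y : PhaseSpace L => y.2 a ^ 2 - T) x = if a = i then 2 * x.2 a else 0 := by
  have hd : Differentiable ℝ (fun y : PhaseSpace L => y.2 a ^ 2) := by fun_prop
  rw [partialP_sub hd (differentiable_const T), DeviceLiouville.partialP_const, sub_zero]
  exact partialP_sq_coord i a x

/-- **Gaussian fourth moments at the pair**: `‖(p²_{N−1} − T) + (p²_N − T)‖²_{L²(μ_T)} = 4T²`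
(`∫ (p_a² − T)² dμ_T = 2T²`, `∫ (p_a² − T)(p_b² − T) dμ_T = 0` for `a ≠ b`, by Gaussian integration by parts). -/
theorem integral_kinPair_sq (hω : 0 < ω₂) (hl : 0 ≤ lam) (hβ : 0 ≤ β) (γ : ℝ) {T : ℝ} (hT : 0 < T)
    (hN : 1 ≤ N) (hM : 1 ≤ M) :
    ∫ x, ((kin (N + M) (N - 1) x - T) + (kin (N + M) N x - T)) ^ 2
        ∂((pinnedChain ω₂ lam β γ).gibbsMeasure (N + M) T) = 4 * T ^ 2 := by
  haveI := pinnedChain_isProbabilityMeasure_gibbsMeasure hω hl hβ γ (N + M) hT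
  set P := pinnedChain ω₂ lam β γ with hP
  set a : Fin (N + M) := ⟨N - 1, by omega⟩ with ha
  set b : Fin (N + M) := ⟨N, by omega⟩ with hb
  have hab : a ≠ b := by
    intro h
    have := congrArg Fin.val h
    simp [ha, hb] at this
    omega
  have hba : b ≠ a := fun h => hab h.symm
  have ek : ∀ x : PhaseSpace (N + M), (kin (N + M) (N - 1) x - T) + (kin (N + M) N x - T) =
      (x.2 a ^ 2 - T) + (x.2 b ^ 2 - T) := fun x => by
    rw [kin_eq_sq_line (s := N - 1) (by omega), kin_eq_sq_line (s := N) (by omega)]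
  have hZ : 0 < ∫ x, P.gibbsDensity (N + M) T x :=
    integral_exp_pos (pinnedChain_integrable_gibbsDensity hω hl hβ γ (N + M) hT)
  -- square integrability
  have hka : MemLp (fun x : PhaseSpace (N + M) => x.2 a ^ 2 - T) 2 (P.gibbsMeasure (N + M) T) :=
    memLp_kinetic hω hl hβ (N + M) hT a
  have hkb : MemLp (fun x : PhaseSpace (N + M) => x.2 b ^ 2 - T) 2 (P.gibbsMeasure (N + M) T) :=
    memLp_kinetic hω hl hβ (N + M) hT b
  have hpa : MemLp (fun x : PhaseSpace (N + M) => x.2 a) 2 (P.gibbsMeasure (N + M) T) :=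
    memLp_momentum hω hl hβ (N + M) hT a
  have hpb : MemLp (fun x : PhaseSpace (N + M) => x.2 b) 2 (P.gibbsMeasure (N + M) T) :=
    memLp_momentum hω hl hβ (N + M) hT b
  -- the three Gaussian moments (Lebesgue form)
  have hda : partialP a (fun y : PhaseSpace (N + M) => y.2 a ^ 2 - T) = fun x => 2 * x.2 a := by
    funext x; rw [partialP_kinetic_coord, if_pos rfl]
  have hdb : partialP b (fun y : PhaseSpace (N + M) => y.2 b ^ 2 - T) = fun x => 2 * x.2 b := by
    funext x; rw [partialP_kinetic_coord, if_pos rfl]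
  have hdab : partialP a (fun y : PhaseSpace (N + M) => y.2 b ^ 2 - T) = fun _ => 0 := by
    funext x; rw [partialP_kinetic_coord, if_neg hba]
  have hC1a : ContDiff ℝ 1 (fun y : PhaseSpace (N + M) => y.2 a ^ 2 - T) := by fun_prop
  have hC1b : ContDiff ℝ 1 (fun y : PhaseSpace (N + M) => y.2 b ^ 2 - T) := by fun_prop
  have maa := gauss_ibp hω hl hβ (N + M) hT a hC1a hka (by rw [hda]; exact hpa.const_mul 2)
  have mbb := gauss_ibp hω hl hβ (N + M) hT b hC1b hkb (by rw [hdb]; exact hpb.const_mul 2)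
  have mab := gauss_ibp hω hl hβ (N + M) hT a hC1b hkb (by rw [hdab]; exact memLp_const 0)
  rw [hda] at maa
  rw [hdb] at mbb
  rw [hdab] at mab
  have h2a := integral_sq_mul_gibbsDensity_eq (γ := γ) hω hl hβ (N + M) hT a
  have h2b := integral_sq_mul_gibbsDensity_eq (γ := γ) hω hl hβ (N + M) hT b
  have maa' : ∫ x, (x.2 a ^ 2 - T) * (x.2 a ^ 2 - T) * P.gibbsDensity (N + M) T x =
      2 * T ^ 2 * ∫ x, P.gibbsDensity (N + M) T x := by
    rw [maa]
    have e : (fun x : PhaseSpace (N + M) => x.2 a * (2 * x.2 a) * P.gibbsDensity (N + M) T x) =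
        fun x => 2 * (x.2 a ^ 2 * P.gibbsDensity (N + M) T x) := by
      funext x; ring
    rw [e, integral_const_mul, h2a]
    ring
  have mbb' : ∫ x, (x.2 b ^ 2 - T) * (x.2 b ^ 2 - T) * P.gibbsDensity (N + M) T x =
      2 * T ^ 2 * ∫ x, P.gibbsDensity (N + M) T x := by
    rw [mbb]
    have e : (fun x : PhaseSpace (N + M) => x.2 b * (2 * x.2 b) * P.gibbsDensity (N + M) T x) =
        fun x => 2 * (x.2 b ^ 2 * P.gibbsDensity (N + M) T x) := by
      funext x; ring
    rw [e, integral_const_mul, h2b]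
    ring
  have mab' : ∫ x, (x.2 a ^ 2 - T) * (x.2 b ^ 2 - T) * P.gibbsDensity (N + M) T x = 0 := by
    rw [mab]
    simp
  -- expand the square (Lebesgue form)
  have Iaa : Integrable fun x => (x.2 a ^ 2 - T) * (x.2 a ^ 2 - T) * P.gibbsDensity (N + M) T x :=
    integrable_mul_mul_gibbsDensity hω hl hβ γ (N + M) hT hka hka
  have Ibb : Integrable fun x => (x.2 b ^ 2 - T) * (x.2 b ^ 2 - T) * P.gibbsDensity (N + M) T x :=
    integrable_mul_mul_gibbsDensity hω hl hβ γ (N + M) hT hkb hkb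
  have Iab : Integrable fun x => (x.2 a ^ 2 - T) * (x.2 b ^ 2 - T) * P.gibbsDensity (N + M) T x :=
    integrable_mul_mul_gibbsDensity hω hl hβ γ (N + M) hT hka hkb
  have hsq : ∫ x, ((x.2 a ^ 2 - T) + (x.2 b ^ 2 - T)) ^ 2 * P.gibbsDensity (N + M) T x =
      4 * T ^ 2 * ∫ x, P.gibbsDensity (N + M) T x := by
    have e : (fun x : PhaseSpace (N + M) => ((x.2 a ^ 2 - T) + (x.2 b ^ 2 - T)) ^ 2 * P.gibbsDensity (N + M) T x) =
        fun x => (x.2 a ^ 2 - T) * (x.2 a ^ 2 - T) * P.gibbsDensity (N + M) T x +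
          2 * ((x.2 a ^ 2 - T) * (x.2 b ^ 2 - T) * P.gibbsDensity (N + M) T x) +
          (x.2 b ^ 2 - T) * (x.2 b ^ 2 - T) * P.gibbsDensity (N + M) T x := by
      funext x; ring
    have I12 : Integrable fun x => (x.2 a ^ 2 - T) * (x.2 a ^ 2 - T) * P.gibbsDensity (N + M) T x +
        2 * ((x.2 a ^ 2 - T) * (x.2 b ^ 2 - T) * P.gibbsDensity (N + M) T x) := Iaa.add (Iab.const_mul 2)
    rw [e, integral_add I12 Ibb, integral_add Iaa (Iab.const_mul 2), integral_const_mul,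
      maa', mbb', mab']
    ring
  rw [P.integral_gibbsMeasure]
  simp only [ek]
  rw [hsq]
  field_simp

/-- **Registered helper `helper_curvaturePairings`** (the three `S_K`-pairings of this part bundled): for the pinned chain
(`ω₂, T > 0`, `lam, β ≥ 0`, `N, M ≥ 1`) and every `f ∈ C²` with `f, S_K f ∈ L²(μ_T)`:
`⟨S_K f, e_K⟩ = ⟨f, (2T − p²_{N−1} − p²_N)/T²⟩`, `∫ S_K f dμ_T = 0`, `‖(p²_{N−1} − T) + (p²_N − T)‖² = 4T²`. -/
theorem helper_curvaturePairings : ∀ (ω₂ lam β γ T : ℝ), 0 < ω₂ → 0 ≤ lam → 0 ≤ β → 0 < T → ∀ (N M : ℕ), 1 ≤ N → 1 ≤ M → ∀ (f : PhaseSpace (N + M) → ℝ), ContDiff ℝ 2 f → MemLp f 2 ((pinnedChain ω₂ lam β γ).gibbsMeasure (N + M) T) → MemLp (junctionOU T N M f) 2 ((pinnedChain ω₂ lam β γ).gibbsMeasure (N + M) T) → (∫ x, junctionOU T N M f x * eK T N M x ∂((pinnedChain ω₂ lam β γ).gibbsMeasure (N + M) T) = ∫ x, f x * ((2 * T - kin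 (N + M) (N - 1) x - kin (N + M) N x) / T ^ 2) ∂((pinnedChain ω₂ lam β γ).gibbsMeasure (N + M) T)) ∧ (∫ x, junctionOU T N M f x ∂((pinnedChain ω₂ lam β γ).gibbsMeasure (N + M) T) = 0) ∧ (∫ x, ((kin (N + M) (N - 1) x - T) + (kin (N + M) N x - T)) ^ 2 ∂((pinnedChain ω₂ lam β γ).gibbsMeasure (N + M) T) = 4 * T ^ 2) := by
  intro ω₂ lam β γ T hω hl hβ hT N M hN hM f hfC hfL2 hSf
  exact ⟨integral_junctionOU_mul_eK hω hl hβ γ hT hN hM hfC hfL2 hSf, integral_junctionOU_eq_zero hω hl hβ γ hT hfC hfL2 hSf,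
    integral_kinPair_sq hω hl hβ γ hT hN hM⟩

end EnergyChannel

end Summit.AtomisticToContinuum.FouriersLaw.Cruxes.SuperadditiveResistance.ThermaliseThenCutProbeInsertion

end
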